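import Literature.MathematicalPhysics.KineticTheory.HardSphereUniformGas
import HarnessLib

/-!
# The collision-flux (window) upper bound for hard-sphere collision sums under an invariant law

Topic `Literature/MathematicalPhysics/KineticTheory`.  For a hard-sphere flow `Φ` (Alexander's flow as a
hypothesis structure, `HardSphereFlow`) and a law `P` preserved by every `Φ_t`, the COLLISION SUM of a
nonnegative MARK `F(w, i, j)` — an arbitrary function of the whole right-continuous configuration `w`
at a collision time and of the ordered colliding pair — along the orbit of `z`,
`K_F(z) = Σ_{collision times s ∈ [0,τ]} Σ_{ordered contact pairs (i,j)} F(Φ_s z, i, j)`,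
is controlled by ONE-WINDOW static quantities (Cercignani–Illner–Pulvirenti 1994, App. 4.A;
Gallagher–Saint-Raymond–Texier 2013, Prop. 4.1.1, "configurations leading to a collision in a short
time interval"):

`P{z good, K_F(z) ≥ η} ≤ η⁻¹ · liminf_M  M · ∫ Σ_{i≠j} 𝟙_{E_M(i,j)} F̃_M(·, i, j) dP`
(`measure_collisionSum_ge_le_liminf`), for any measurable events `E_M(i,j) ⊇ {the pair (i,j) reaches
contact under a backward free flight of duration ≤ τ/M}` and measurable majorants `F̃_M ≥ F` along those
flights.  The proof is organised so that NO measurability of the collision sum and NO surface measure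
is needed:

* `exists_gap_of_finite`, `sum_collision_le_sum_window` — PATHWISE: on a good orbit the collision times
  in `[0, τ]` are finitely many; once the mesh `h = τ/M` is finer than their minimal gap, the collision
  at time `s` is followed by free flight up to the next grid time `kh`, `k = max(1, ⌈s/h⌉)`, so the
  grid configuration `Φ_{kh} z` lies in the one-window event of the colliding pair, and
  `F(Φ_s z, i, j) = F(S_{−(kh−s)} Φ_{kh} z, i, j) ≤ F̃(Φ_{kh} z, i, j)`; distinct collision times go to
  distinct grid times, whence `K_F(z) ≤ Σ_{k=1}^{M} W_M(Φ_{kh} z)`, `W_M = Σ_{i≠j} 𝟙_{E_M(i,j)} F̃_M`;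
* `measure_collisionSum_ge_le_liminf` — hence `K_F ≤ liminf_M Σ_{k ≤ M} W_M ∘ Φ_{kτ/M}` on the good
  set, a MEASURABLE majorant; Fatou (`lintegral_liminf_le`), stationarity (`∫ W_M ∘ Φ_{kh} dP = ∫ W_M`)
  and Markov's inequality conclude (the geometry, the law `P` and the events are abstract here);
* `exists_latticeVec_add_mem_of_contact` — GEOMETRY of the one-window event on the torus `𝕋³`: a lift
  `reprSym (xᵢ − xⱼ) + k`, `k ∈ ℤ³`, of the relative position lies in the swept tube of the relative
  velocity (minimality of the symmetric representative among the lifts, `proj_eq_proj_iff_holds`);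
* `exists_windowEvent` — STATICS at rung 0 (constant profiles): the homogeneous local Gibbs law is
  `posGibbs ⊗ N(u,θ)^{⊗(N+1)}` (`localGibbsMeasure_rung0_eq_map`), so the probability of the one-window
  event weighted by a measurable function `A(vᵢ, vⱼ)` of the two velocities is at most
  `16 ε² h ∫ ‖w − v‖ A`, given (as hypotheses, supplied by the consumer) a swept-tube family of volume
  `≤ 4 ε² h ‖u‖`, the Haar-versus-Lebesgue inequality for minimal-image lifts, and a canonical pair law
  at most `4 ×` Haar measure (the Ruelle-type bound `posGibbs_pairEvent_le` at small reduced density);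
* `localGibbsLaw_collisionMarkSum_ge_le` — the resulting COLLISION-FLUX UPPER BOUND for marks
  `b(vᵢ, vⱼ) ≥ 0` of the two (post-collisional) velocities:
  `G_N{K_b ≥ η} ≤ η⁻¹ · 16 τ (N+1)² ε² · ∫ ‖w − v‖ b(v, w) dN(u,θ)(v) dN(u,θ)(w)`, i.e.
  `E[ε/(N+1) · K_b] ≲ τ σ³ ∫ ‖w − v‖ b`: the Boltzmann–Enskog collision flux through the contact
  cylinders bounds the mean collision sum, uniformly in `N` (the mesh cancels EXACTLY, `M · h = τ`).

Also: `norm_snd_sub_fst_reflectVel` (the elastic reflection in an unnormalised direction preserves the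
modulus of the relative velocity), `exists_bound_of_cutoff`, `lintegral_pi_pair`,
`posGibbsMeasure_const_eq_one` — small inputs of the consumers (the crux line
`even-rung-mean-variance` of `JParityClosure.EvenStressEnskog`, stmt-AtomisticToContinuum-13079, whose
three-label window events are controlled the same way by `measure_collisionSum_ge_le_liminf`).

## References

* C. Cercignani, R. Illner, M. Pulvirenti, *The Mathematical Theory of Dilute Gases* (1994),
  App. 4.A.  [CIPDiluteGases1994]
* I. Gallagher, L. Saint-Raymond, B. Texier, *From Newton to Boltzmann* (2013), Prop. 4.1.1.  [GST2013]
* H. Spohn, *Large Scale Dynamics of Interacting Particles* (1991), Part I §2.3.  [Spohn1991]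
-/

noncomputable section

open MeasureTheory Set Filter Topology
open scoped ENNReal InnerProductSpace BigOperators

namespace Literature.MathematicalPhysics.KineticTheory

open Literature.Analysis.FluidPDE Literature.Analysis.FunctionSpaces

/-! ## Pathwise: collisions are followed by free flight up to the next grid time -/

/-- A finite set of reals has a positive gap: some `g > 0` separates any two of its elements.
[folklore] -/
theorem exists_gap_of_finite {S : Set ℝ} (hS : S.Finite) :
    ∃ g : ℝ, 0 < g ∧ ∀ s ∈ S, ∀ s' ∈ S, s < s' → g ≤ s' - s := by
  classical
  set D : Finset ℝ := ((hS.toFinset ×ˢ hS.toFinset).filter (fun p => p.1 < p.2)).image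
    (fun p => p.2 - p.1) with hD
  have hmem : ∀ s ∈ S, ∀ s' ∈ S, s < s' → s' - s ∈ D := by
    intro s hs s' hs' hlt
    rw [hD, Finset.mem_image]
    exact ⟨(s, s'), Finset.mem_filter.2 ⟨Finset.mem_product.2 ⟨hS.mem_toFinset.2 hs,
      hS.mem_toFinset.2 hs'⟩, hlt⟩, rfl⟩
  by_cases hne : D.Nonempty
  · refine ⟨D.min' hne, ?_, fun s hs s' hs' hlt => D.min'_le _ (hmem s hs s' hs' hlt)⟩
    have h : D.min' hne ∈ ((hS.toFinset ×ˢ hS.toFinset).filter (fun p => p.1 < p.2)).image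
        (fun p => p.2 - p.1) := D.min'_mem hne
    rw [Finset.mem_image] at h
    obtain ⟨p, hp, hpeq⟩ := h
    rw [Finset.mem_filter] at hp
    have hpeq' : p.2 - p.1 = D.min' hne := hpeq
    linarith [hp.2]
  · refine ⟨1, one_pos, fun s hs s' hs' hlt => ?_⟩
    exact absurd ⟨_, hmem s hs s' hs' hlt⟩ hne

/-- **Pathwise window bound.** Let `γ` be a hard-sphere trajectory, `τ > 0`, `M ≥ 1`, and suppose the
mesh `h = τ/M` is smaller than the gap between any two collision times in `[0, τ]`.  Let `E i j` be
events containing every non-overlapping configuration `w` whose pair `(i, j)` comes to contact after a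
backward free flight of some duration `t ∈ [0, h]`, and let the MARK `F(w, i, j) ∈ ℝ≥0∞` — an arbitrary
function of the whole (right-continuous, i.e. post-collisional) configuration at the collision and of
the ordered colliding pair — be majorised in that situation by `F̃(w, i, j)` read at the END of the
backward flight: `F(S_{−t} w, i, j) ≤ F̃(w, i, j)` (`hFt`; e.g. `F̃ = F` for a mark of the velocities,
the supremum over the window for a mark continuous along free flight).  Then the collision sum
`Σ_{collision times s ∈ [0,τ]} Σ_{ordered contact pairs (i,j)} F(γ(s), i, j)` is at most the grid sum
`Σ_{k=1}^{M} Σ_{i≠j} 𝟙_{E i j}(γ(kh)) F̃(γ(kh), i, j)`. [folklore] -/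
theorem sum_collision_le_sum_window {d X : Type*} [Fintype d] [TopologicalSpace X] {G : Geometry d X}
    {ε : ℝ} {n : ℕ} {γ : ℝ → Config n d X} (hγ : IsHardSphereTrajectory G ε n γ) {τ : ℝ} (hτ : 0 < τ)
    {M : ℕ} (hM : 0 < M)
    (hgap : ∀ s ∈ collisionTimes G ε γ ∩ Icc 0 τ, ∀ s' ∈ collisionTimes G ε γ ∩ Icc 0 τ,
      s < s' → τ / M < s' - s)
    (E : Fin n → Fin n → Set (Config n d X))
    (hE : ∀ i j, i ≠ j → ∀ w ∈ hardSphereDomain G n ε, ∀ t ∈ Icc 0 (τ / M),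
      ‖G.sepVec ((freeFlight G (-t) w i).1) ((freeFlight G (-t) w j).1)‖ = ε → w ∈ E i j)
    (F Ft : Config n d X → Fin n → Fin n → ℝ≥0∞)
    (hFt : ∀ i j, i ≠ j → ∀ w ∈ hardSphereDomain G n ε, ∀ t ∈ Icc 0 (τ / M),
      ‖G.sepVec ((freeFlight G (-t) w i).1) ((freeFlight G (-t) w j).1)‖ = ε →
        F (freeFlight G (-t) w) i j ≤ Ft w i j) :
    ∑ s ∈ (hγ.locFinite 0 τ).toFinset, ∑ i, ∑ j,
        (if i ≠ j ∧ ‖G.sepVec (γ s i).1 (γ s j).1‖ = ε then F (γ s) i j else 0) ≤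
      ∑ k ∈ Finset.Icc 1 M, ∑ i, ∑ j,
        (if i ≠ j then (E i j).indicator (fun w => Ft w i j) (γ ((k : ℝ) * (τ / M))) else 0) := by
  classical
  set h : ℝ := τ / M with hhdef
  have hM' : (0 : ℝ) < M := by exact_mod_cast hM
  have hh : 0 < h := div_pos hτ hM'
  have hMh : (M : ℝ) * h = τ := by rw [hhdef]; field_simp
  set S : Set ℝ := collisionTimes G ε γ ∩ Icc 0 τ with hSdef
  set T : Finset ℝ := (hγ.locFinite 0 τ).toFinset with hTdef
  have hTS : ∀ s, s ∈ T ↔ s ∈ S := fun s => (hγ.locFinite 0 τ).mem_toFinset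
  -- the grid index of a collision time
  set κ : ℝ → ℕ := fun s => max 1 ⌈s / h⌉₊ with hκ
  have hκ1 : ∀ s, 1 ≤ κ s := fun s => le_max_left _ _
  have hκM : ∀ s ∈ S, κ s ≤ M := by
    intro s hs
    refine max_le hM (Nat.ceil_le.2 ?_)
    rw [div_le_iff₀ hh, hMh]
    exact hs.2.2
  have hκle : ∀ s ∈ S, s ≤ κ s * h := by
    intro s _
    have h1 : s / h ≤ (⌈s / h⌉₊ : ℝ) := Nat.le_ceil _
    have h2 : (⌈s / h⌉₊ : ℝ) ≤ (κ s : ℝ) := by rw [hκ]; exact_mod_cast le_max_right _ _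
    rw [div_le_iff₀ hh] at h1
    nlinarith
  have hκlt : ∀ s ∈ S, (κ s : ℝ) * h - s ≤ h := by
    intro s hs
    have hs0 : 0 ≤ s / h := div_nonneg hs.2.1 hh.le
    have h1 : (⌈s / h⌉₊ : ℝ) < s / h + 1 := Nat.ceil_lt_add_one hs0
    have h2 : (κ s : ℝ) ≤ s / h + 1 := by
      rw [hκ, Nat.cast_max, Nat.cast_one, max_le_iff]
      exact ⟨by linarith, h1.le⟩
    have h3 : (κ s : ℝ) * h ≤ (s / h + 1) * h := mul_le_mul_of_nonneg_right h2 hh.le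
    rw [add_mul, div_mul_cancel₀ _ hh.ne', one_mul] at h3
    linarith
  -- no collision between `s` and its grid time
  have hfreeI : ∀ s ∈ S, ∀ s' ∈ Ioc s ((κ s : ℝ) * h), s' ∉ collisionTimes G ε γ := by
    intro s hs s' hs' hcoll
    have hs'S : s' ∈ S := by
      refine ⟨hcoll, hs.2.1.trans hs'.1.le, hs'.2.trans ?_⟩
      calc (κ s : ℝ) * h ≤ M * h := mul_le_mul_of_nonneg_right (by exact_mod_cast hκM s hs) hh.le
        _ = τ := hMh
    have h1 := hgap s hs s' hs'S hs'.1
    have h2 := hκlt s hs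
    linarith [hs'.2]
  have hflight : ∀ s ∈ S, γ ((κ s : ℝ) * h) = freeFlight G ((κ s : ℝ) * h - s) (γ s) := fun s hs =>
    hγ.free s _ (hκle s hs) (hfreeI s hs)
  -- distinct collision times have distinct grid times
  have hinj : Set.InjOn κ (T : Set ℝ) := by
    have key : ∀ s ∈ S, ∀ s' ∈ S, s < s' → κ s ≠ κ s' := by
      intro s hs s' hs' hlt heq
      have h1 := hgap s hs s' hs' hlt
      have h2 := hκle s' hs'
      have h3 := hκlt s hs
      rw [heq] at h3
      linarith
    intro s hs s' hs' heq
    rw [Finset.mem_coe, hTS] at hs hs'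
    rcases lt_trichotomy s s' with hlt | heq' | hgt
    · exact absurd heq (key s hs s' hs' hlt)
    · exact heq'
    · exact absurd heq.symm (key s' hs' s hs hgt)
  -- the one-window functional
  set W : Config n d X → ℝ≥0∞ := fun w => ∑ i, ∑ j,
    (if i ≠ j then (E i j).indicator (fun w => Ft w i j) w else 0) with hW
  -- termwise comparison at a collision time
  have hterm : ∀ s ∈ S, (∑ i, ∑ j,
      (if i ≠ j ∧ ‖G.sepVec (γ s i).1 (γ s j).1‖ = ε then F (γ s) i j else 0)) ≤
        W (γ ((κ s : ℝ) * h)) := by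
    intro s hs
    rw [hW]
    refine Finset.sum_le_sum fun i _ => Finset.sum_le_sum fun j _ => ?_
    by_cases hc : i ≠ j ∧ ‖G.sepVec (γ s i).1 (γ s j).1‖ = ε
    · rw [if_pos hc, if_pos hc.1]
      set t : ℝ := (κ s : ℝ) * h - s with htdef
      have ht : t ∈ Icc 0 h := ⟨by rw [htdef]; linarith [hκle s hs], hκlt s hs⟩
      have hw : γ ((κ s : ℝ) * h) = freeFlight G t (γ s) := hflight s hs
      have hback : freeFlight G (-t) (γ ((κ s : ℝ) * h)) = γ s := by
        rw [hw, ← freeFlight_add, neg_add_cancel, freeFlight_zero]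
      have hcontact : ‖G.sepVec ((freeFlight G (-t) (γ ((κ s : ℝ) * h)) i).1)
          ((freeFlight G (-t) (γ ((κ s : ℝ) * h)) j).1)‖ = ε := by
        rw [hback]
        exact hc.2
      have hmem : γ ((κ s : ℝ) * h) ∈ E i j := hE i j hc.1 _ (hγ.mem _) t ht hcontact
      rw [indicator_of_mem hmem]
      have hle := hFt i j hc.1 _ (hγ.mem _) t ht hcontact
      rwa [hback] at hle
    · rw [if_neg hc]
      exact bot_le
  -- sum over collision times ≤ sum over grid times
  calc ∑ s ∈ T, ∑ i, ∑ j,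
        (if i ≠ j ∧ ‖G.sepVec (γ s i).1 (γ s j).1‖ = ε then F (γ s) i j else 0)
      ≤ ∑ s ∈ T, W (γ ((κ s : ℝ) * h)) :=
        Finset.sum_le_sum fun s hs => hterm s ((hTS s).1 hs)
    _ = ∑ k ∈ T.image κ, W (γ ((k : ℝ) * h)) :=
        (Finset.sum_image (f := fun k : ℕ => W (γ ((k : ℝ) * h))) hinj).symm
    _ ≤ ∑ k ∈ Finset.Icc 1 M, W (γ ((k : ℝ) * h)) := by
        refine Finset.sum_le_sum_of_subset fun k hk => ?_
        rw [Finset.mem_image] at hk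
        obtain ⟨s, hs, rfl⟩ := hk
        exact Finset.mem_Icc.2 ⟨hκ1 s, hκM s ((hTS s).1 hs)⟩

/-! ## Windows, stationarity, Fatou, Markov: the collision sum against an invariant law -/

/-- **The window bound for collision sums under a flow-invariant law (Markov form).** Let `Φ` be a
hard-sphere flow, `P` a law preserved by every `Φ_t` (`hstat`), `τ > 0`, and `F(w, i, j) ∈ ℝ≥0∞` an
ARBITRARY mark of the configuration at a collision and of the ordered colliding pair (no measurability
is asked of `F` or of the collision sum).  Suppose that for every mesh `τ/M` we are given measurable
one-window events `E M i j` (containing every non-overlapping `w` whose pair `(i, j)` reaches contact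
under a backward free flight of duration `t ∈ [0, τ/M]`, `hE`) and measurable majorants `F̃ M (·, i, j)`
of the mark along those flights (`hFt`).  Then for `0 < η < ∞`,
`P{z good, Σ_{collision times s ∈ [0,τ]} Σ_{ordered contact pairs (i,j)} F(Φ_s z, i, j) ≥ η}
   ≤ η⁻¹ · liminf_M  M · ∫ Σ_{i≠j} 𝟙_{E M i j} F̃ M (·, i, j) dP`:
pathwise the collision sum is eventually below the grid sum `Σ_{k=1}^{M} W_M(Φ_{kτ/M} z)`
(`sum_collision_le_sum_window`, once `τ/M` is below the gap of the collision times,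
`exists_gap_of_finite`), hence below the MEASURABLE `liminf_M` of the grid sums; Fatou
(`lintegral_liminf_le`) and stationarity (`∫ W_M ∘ Φ_{kh} dP = ∫ W_M dP`, so each grid sum has mean
`M ∫ W_M dP`) bound its mean, and Markov's inequality concludes
(Cercignani–Illner–Pulvirenti 1994 App. 4.A). [folklore] -/
theorem measure_collisionSum_ge_le_liminf {d X : Type*} [Fintype d] [MeasureSpace X] [TopologicalSpace X]
    {G : Geometry d X} {ε : ℝ} {n : ℕ} (Φ : HardSphereFlow G ε n) (P : Measure (Config n d X))
    (hstat : ∀ t : ℝ, MeasurePreserving (Φ.flow t) P P) {τ : ℝ} (hτ : 0 < τ)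
    (F : Config n d X → Fin n → Fin n → ℝ≥0∞) (E : ℕ → Fin n → Fin n → Set (Config n d X))
    (hEm : ∀ M i j, MeasurableSet (E M i j))
    (hE : ∀ (M : ℕ) (i j : Fin n), i ≠ j → ∀ w ∈ hardSphereDomain G n ε, ∀ t ∈ Icc 0 (τ / M),
      ‖G.sepVec ((freeFlight G (-t) w i).1) ((freeFlight G (-t) w j).1)‖ = ε → w ∈ E M i j)
    (Ft : ℕ → Config n d X → Fin n → Fin n → ℝ≥0∞) (hFtm : ∀ M i j, Measurable fun w => Ft M w i j)
    (hFt : ∀ (M : ℕ) (i j : Fin n), i ≠ j → ∀ w ∈ hardSphereDomain G n ε, ∀ t ∈ Icc 0 (τ / M),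
      ‖G.sepVec ((freeFlight G (-t) w i).1) ((freeFlight G (-t) w j).1)‖ = ε →
        F (freeFlight G (-t) w) i j ≤ Ft M w i j)
    {η : ℝ≥0∞} (hη : η ≠ 0) (hη' : η ≠ ∞) :
    P {z | z ∈ Φ.good ∧ η ≤ ∑ᶠ s ∈ collisionTimes G ε (fun t => Φ.flow t z) ∩ Icc 0 τ,
        ∑ i, ∑ j, (if i ≠ j ∧ ‖G.sepVec (Φ.flow s z i).1 (Φ.flow s z j).1‖ = ε
          then F (Φ.flow s z) i j else 0)} ≤
      η⁻¹ * liminf (fun M : ℕ => (M : ℝ≥0∞) *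
        ∫⁻ w, ∑ i, ∑ j, (if i ≠ j then (E M i j).indicator (fun w => Ft M w i j) w else 0) ∂P) atTop := by
  classical
  -- the one-window functional and the grid sums
  set W : ℕ → Config n d X → ℝ≥0∞ := fun M w => ∑ i, ∑ j,
    (if i ≠ j then (E M i j).indicator (fun w => Ft M w i j) w else 0) with hWdef
  have hWm : ∀ M, Measurable (W M) := by
    intro M
    refine Finset.measurable_sum _ fun i _ => Finset.measurable_sum _ fun j _ => ?_
    by_cases hij : i ≠ j
    · simp only [if_pos hij]
      exact (hFtm M i j).indicator (hEm M i j)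
    · simp only [if_neg hij]
      exact measurable_const
  set SM : ℕ → Config n d X → ℝ≥0∞ := fun M z =>
    ∑ k ∈ Finset.Icc 1 M, W M (Φ.flow ((k : ℝ) * (τ / M)) z) with hSMdef
  have hSMm : ∀ M, Measurable (SM M) := fun M =>
    Finset.measurable_sum _ fun k _ => (hWm M).comp (Φ.measurable_flow _)
  set Kstar : Config n d X → ℝ≥0∞ := fun z => liminf (fun M => SM M z) atTop with hKdef
  have hKm : Measurable Kstar := Measurable.liminf hSMm
  -- (i) the pathwise bound on the good set
  have hpath : ∀ z ∈ Φ.good, (∑ᶠ s ∈ collisionTimes G ε (fun t => Φ.flow t z) ∩ Icc 0 τ,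
      ∑ i, ∑ j, (if i ≠ j ∧ ‖G.sepVec (Φ.flow s z i).1 (Φ.flow s z j).1‖ = ε
        then F (Φ.flow s z) i j else 0)) ≤ Kstar z := by
    intro z hz
    have hγ := Φ.isTrajectory z hz
    have hfin := hγ.locFinite 0 τ
    rw [finsum_mem_eq_finite_toFinset_sum _ hfin]
    obtain ⟨g, hg, hgap⟩ := exists_gap_of_finite hfin
    show _ ≤ liminf (fun M => SM M z) atTop
    refine le_liminf_of_le (h := ?_)
    filter_upwards [eventually_gt_atTop ⌈τ / g⌉₊] with M hM
    have hM0 : 0 < M := lt_of_le_of_lt (Nat.zero_le _) hM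
    have hMg : τ / M < g := by
      have h1 : τ / g < M := (Nat.le_ceil _).trans_lt (by exact_mod_cast hM)
      rw [div_lt_iff₀ hg] at h1
      rw [div_lt_iff₀ (by exact_mod_cast hM0)]
      linarith
    have hgap' : ∀ s ∈ collisionTimes G ε (fun t => Φ.flow t z) ∩ Icc 0 τ,
        ∀ s' ∈ collisionTimes G ε (fun t => Φ.flow t z) ∩ Icc 0 τ, s < s' → τ / M < s' - s :=
      fun s hs s' hs' hlt => hMg.trans_le (hgap s hs s' hs' hlt)
    exact sum_collision_le_sum_window hγ hτ hM0 hgap' (E M) (hE M) F (Ft M) (hFt M)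
  -- (ii) the mean of each grid sum: stationarity
  have hmeanM : ∀ M, ∫⁻ z, SM M z ∂P = (M : ℝ≥0∞) * ∫⁻ w, W M w ∂P := by
    intro M
    calc ∫⁻ z, SM M z ∂P = ∑ k ∈ Finset.Icc 1 M, ∫⁻ z, W M (Φ.flow ((k : ℝ) * (τ / M)) z) ∂P :=
          lintegral_finsetSum _ fun k _ => (hWm M).comp (Φ.measurable_flow _)
      _ = ∑ _k ∈ Finset.Icc 1 M, ∫⁻ z, W M z ∂P :=
          Finset.sum_congr rfl fun k _ => (hstat _).lintegral_comp (hWm M)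
      _ = (M : ℝ≥0∞) * ∫⁻ w, W M w ∂P := by
          rw [Finset.sum_const, Nat.card_Icc, Nat.add_sub_cancel, nsmul_eq_mul]
  -- (iii) Fatou
  have hmean : ∫⁻ z, Kstar z ∂P ≤ liminf (fun M : ℕ => (M : ℝ≥0∞) * ∫⁻ w, W M w ∂P) atTop := by
    refine (lintegral_liminf_le hSMm).trans (le_of_eq ?_)
    exact congrArg (fun u : ℕ → ℝ≥0∞ => liminf u atTop) (funext hmeanM)
  -- (iv) Markov
  have hsub : {z | z ∈ Φ.good ∧ η ≤ ∑ᶠ s ∈ collisionTimes G ε (fun t => Φ.flow t z) ∩ Icc 0 τ,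
      ∑ i, ∑ j, (if i ≠ j ∧ ‖G.sepVec (Φ.flow s z i).1 (Φ.flow s z j).1‖ = ε
        then F (Φ.flow s z) i j else 0)} ⊆ {z | η ≤ Kstar z} :=
    fun z hz => hz.2.trans (hpath z hz.1)
  calc P _ ≤ P {z | η ≤ Kstar z} := measure_mono hsub
    _ ≤ (∫⁻ z, Kstar z ∂P) / η := meas_ge_le_lintegral_div hKm.aemeasurable hη hη'
    _ = η⁻¹ * ∫⁻ z, Kstar z ∂P := by rw [ENNReal.div_eq_inv_mul]
    _ ≤ η⁻¹ * liminf (fun M : ℕ => (M : ℝ≥0∞) * ∫⁻ w, W M w ∂P) atTop := by gcongr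

/-! ## Small inputs -/

/-- The elastic reflection (unnormalised direction, junk identity at `n = 0`) preserves the modulus of
the relative velocity: `‖w' − v'‖ = ‖w − v‖`. [folklore] -/
theorem norm_snd_sub_fst_reflectVel (n : V3) (p : V3 × V3) :
    ‖(reflectVel n p).2 - (reflectVel n p).1‖ = ‖p.2 - p.1‖ := by
  by_cases hn : n = 0
  · subst hn; simp
  set c : ℝ := ⟪p.1 - p.2, n⟫_ℝ / ‖n‖ ^ 2 with hc
  have hn2 : ‖n‖ ^ 2 ≠ 0 := pow_ne_zero 2 (norm_ne_zero_iff.2 hn)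
  have hcn : c * ‖n‖ ^ 2 = ⟪p.1 - p.2, n⟫_ℝ := by rw [hc, div_mul_cancel₀ _ hn2]
  have hdiff : (reflectVel n p).2 - (reflectVel n p).1 = (p.2 - p.1) + (2 * c) • n := by
    simp only [reflectVel, ← hc, mul_smul, two_smul]
    abel
  have hinner : ⟪p.2 - p.1, n⟫_ℝ = -⟪p.1 - p.2, n⟫_ℝ := by rw [← inner_neg_left, neg_sub]
  rw [← sq_eq_sq₀ (norm_nonneg _) (norm_nonneg _), hdiff, norm_add_sq_real, inner_smul_right, hinner,
    norm_smul, mul_pow, Real.norm_eq_abs, sq_abs, ← hcn]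
  ring

/-- A continuous Enskog factor vanishing beyond `ηK` is bounded on `[0, ∞)`. [folklore] -/
theorem exists_bound_of_cutoff {g : ℝ → ℝ} {ηK : ℝ} (hg : Continuous g) (hg1 : ∀ b, ηK ≤ b → g b = 0) :
    ∃ C : ℝ, 0 ≤ C ∧ ∀ x, 0 ≤ x → g x ≤ C := by
  obtain ⟨C, hC⟩ := (isCompact_Icc (a := (0 : ℝ)) (b := ηK)).exists_bound_of_continuousOn hg.continuousOn
  refine ⟨max C 0, le_max_right _ _, fun x hx => ?_⟩
  by_cases hxK : ηK ≤ x
  · rw [hg1 x hxK]; exact le_max_right _ _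
  · have h := hC x ⟨hx, (not_le.1 hxK).le⟩
    rw [Real.norm_eq_abs] at h
    exact ((le_abs_self _).trans h).trans (le_max_left _ _)

/-! ### Geometry of the backward free flight on the torus -/

/-- The symmetric representative is the shortest lift: `‖reprSym p‖ ≤ ‖reprSym p + k‖` for every
lattice vector `k`. [folklore] -/
theorem norm_reprSym_le_norm_add_latticeVec (p : T3) (k : Fin 3 → ℤ) :
    ‖Torus.reprSym p‖ ≤ ‖Torus.reprSym p + Torus.latticeVec k‖ :=
  Torus.norm_reprSym_le_of_proj_eq (by rw [Torus.proj_add_latticeVec, Torus.proj_reprSym])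

/-- The separation vector of the pair `(i, j)` after a backward free flight of duration `t` on `𝕋³`:
`sep = reprSym ((xᵢ − xⱼ) + proj (t (vⱼ − vᵢ)))`. [folklore] -/
theorem sepVec_freeFlight_neg {N : ℕ} (w : Config N (Fin 3) T3) (t : ℝ) (i j : Fin N) :
    (Torus.geometry (Fin 3)).sepVec ((freeFlight (Torus.geometry (Fin 3)) (-t) w i).1)
        ((freeFlight (Torus.geometry (Fin 3)) (-t) w j).1) =
      Torus.reprSym (((w i).1 - (w j).1) + Torus.proj (t • ((w j).2 - (w i).2))) := by
  simp only [freeFlight_apply, Torus.geometry_translate, Torus.geometry_sepVec]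
  congr 1
  have h : (-t) • (w i).2 - (-t) • (w j).2 = t • ((w j).2 - (w i).2) := by
    rw [smul_sub, neg_smul, neg_smul]; abel
  have hps : ∀ a b : V3, Torus.proj (a - b) = Torus.proj a - Torus.proj b := fun _ _ => rfl
  rw [← h, hps]
  abel

/-- **Contact within backward time `h` puts a lift of the relative position in the swept tube.** If
`w` does not overlap at diameter `ε`, `t ∈ [0, h]`, and the pair `(i, j)` of `freeFlight (−t) w` is at
contact, then `reprSym (xᵢ − xⱼ) + k ∈ S (vⱼ − vᵢ)` for some `k ∈ ℤ³`, for every family `S` with the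
covering property `hS` of a swept-tube family. [folklore] -/
theorem exists_latticeVec_add_mem_of_contact {N : ℕ} {ε h : ℝ} {S : V3 → Set V3}
    (hS : ∀ (u r : V3) (s : ℝ), ε ≤ ‖r‖ → s ∈ Icc 0 h → ‖r + s • u‖ = ε → r ∈ S u)
    {w : Config N (Fin 3) T3} (hw : w ∈ hardSphereDomain (Torus.geometry (Fin 3)) N ε)
    {i j : Fin N} (hij : i ≠ j) {t : ℝ} (ht : t ∈ Icc 0 h)
    (hc : ‖(Torus.geometry (Fin 3)).sepVec ((freeFlight (Torus.geometry (Fin 3)) (-t) w i).1)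
        ((freeFlight (Torus.geometry (Fin 3)) (-t) w j).1)‖ = ε) :
    ∃ k : Fin 3 → ℤ, Torus.reprSym ((w i).1 - (w j).1) + Torus.latticeVec k ∈ S ((w j).2 - (w i).2) := by
  set p : T3 := (w i).1 - (w j).1 with hp
  set q : V3 := Torus.reprSym p with hq
  set u : V3 := (w j).2 - (w i).2 with hu
  rw [sepVec_freeFlight_neg] at hc
  have h2 : Torus.proj (q + t • u) = Torus.proj (Torus.reprSym (p + Torus.proj (t • u))) := by
    rw [Torus.proj_reprSym, Torus.proj_add, hq, Torus.proj_reprSym]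
  obtain ⟨k, hk⟩ := (Torus.proj_eq_proj_iff_holds (q + t • u) _).1 h2
  refine ⟨k, hS u (q + Torus.latticeVec k) t ?_ ht ?_⟩
  · have hε : ε ≤ ‖q‖ := hw i j hij
    exact hε.trans (norm_reprSym_le_norm_add_latticeVec p k)
  · have : q + Torus.latticeVec k + t • u = q + t • u + Torus.latticeVec k := by abel
    rw [this, ← hk, hc]

/-! ### The rung-0 law: constant activity, pair marginal of the velocities -/

/-- For a constant activity `a > 0` the configurational Gibbs measure is that of activity `1`
(the factor `aⁿ` cancels against the partition function). [folklore] -/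
theorem posGibbsMeasure_const_eq_one {a : ℝ} (ha : 0 < a) (ε : ℝ) (n : ℕ) :
    posGibbsMeasure (fun _ : T3 => a) ε n = posGibbsMeasure (fun _ : T3 => (1 : ℝ)) ε n := by
  rw [posGibbsMeasure_eq continuous_const (fun _ => ha) ε n,
    posGibbsMeasure_eq continuous_const (fun _ => one_pos) ε n, profileOf_const ha,
    profileOf_const one_pos]

/-- Two distinct coordinates of a product probability measure are jointly distributed as the product
of two factors (`lintegral` form). [folklore] -/
theorem lintegral_pi_pair {ι X : Type*} [Fintype ι] [MeasurableSpace X] (γ : Measure X)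
    [IsProbabilityMeasure γ] {i j : ι} (hij : i ≠ j) {f : X × X → ℝ≥0∞} (hf : Measurable f) :
    ∫⁻ v, f (v i, v j) ∂Measure.pi (fun _ : ι => γ) = ∫⁻ p, f p ∂(γ.prod γ) := by
  have hind : _root_.ProbabilityTheory.IndepFun (fun v : ι → X => v i) (fun v => v j)
      (Measure.pi fun _ : ι => γ) :=
    (_root_.ProbabilityTheory.iIndepFun_pi (μ := fun _ : ι => γ) (X := fun _ => id)
      fun _ => aemeasurable_id).indepFun hij
  have hev : ∀ k : ι, (Measure.pi fun _ : ι => γ).map (fun v => v k) = γ := fun k =>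
    (measurePreserving_eval (fun _ : ι => γ) k).map_eq
  have hmap : (Measure.pi fun _ : ι => γ).map (fun v => (v i, v j)) = γ.prod γ := by
    rw [(_root_.ProbabilityTheory.indepFun_iff_map_prod_eq_prod_map_map (measurable_pi_apply i).aemeasurable
      (measurable_pi_apply j).aemeasurable).1 hind, hev i, hev j]
  rw [← hmap, lintegral_map hf ((measurable_pi_apply i).prodMk (measurable_pi_apply j))]

/-! ### The one-window event and its static bound -/

/-- **The one-window collision event and its static Gibbs bound.** For `σ ≤ 1/2`, constant
profiles `a, θ > 0`, `u`, `N + 1` spheres of diameter `ε = hsDiameter σ N`, a window length `h ≥ 0` and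
labels `i ≠ j` whose canonical pair law is at most `4 ×` Haar measure (`hpair`), given a measurable
swept-tube family `S` (`hS`: it contains every relative position `r`, `‖r‖ ≥ ε`, from which free
relative motion at velocity `u` reaches the contact sphere within time `h`; `hSvol`:
`vol (S u) ≤ 4 ε² h ‖u‖`) and the Haar-versus-Lebesgue inequality for minimal-image lifts (`hlift`),
there is a measurable event `E` of phase space such that
(i) every non-overlapping configuration whose pair `(i, j)` comes to contact after a backward free
flight of some duration `t ∈ [0, h]` lies in `E`;
(ii) for every flow `Φ` (dummy) and every measurable weight `A` of the two velocities,
`∫ 𝟙_E(w) A(vᵢ, vⱼ) dG_N(w) ≤ 16 ε² h · ∫ ‖p.2 − p.1‖ A(p) d(N(u,θ) ⊗ N(u,θ))(p)`.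
[folklore] -/
theorem exists_windowEvent {σ : ℝ} (hσ2 : σ ≤ 1 / 2) {a θ : ℝ} (ha : 0 < a)
    (hθ : 0 < θ) (u : V3) {N : ℕ} {h : ℝ} (hh : 0 ≤ h) {i j : Fin (N + 1)} (hij : i ≠ j)
    (hpair : ∀ T : Set T3, MeasurableSet T →
      posGibbsMeasure (fun _ : T3 => (1 : ℝ)) (hsDiameter σ N) (N + 1) {x | x i - x j ∈ T} ≤ 4 * volume T)
    {S : V3 → Set V3} (hSm : MeasurableSet {q : V3 × V3 | q.1 ∈ S q.2})
    (hSvol : ∀ u, volume (S u) ≤ ENNReal.ofReal (4 * hsDiameter σ N ^ 2 * h * ‖u‖))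
    (hS : ∀ (u r : V3) (s : ℝ), hsDiameter σ N ≤ ‖r‖ → s ∈ Icc 0 h → ‖r + s • u‖ = hsDiameter σ N → r ∈ S u)
    (hlift : ∀ B : Set V3, MeasurableSet B →
      volume {x : T3 | ∃ k : Fin 3 → ℤ, Torus.reprSym x + Torus.latticeVec k ∈ B} ≤ volume B) :
    ∃ E : Set (Config (N + 1) (Fin 3) T3), MeasurableSet E ∧
      (∀ w ∈ hardSphereDomain (Torus.geometry (Fin 3)) (N + 1) (hsDiameter σ N), ∀ t ∈ Icc 0 h,
        ‖(Torus.geometry (Fin 3)).sepVec ((freeFlight (Torus.geometry (Fin 3)) (-t) w i).1)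
            ((freeFlight (Torus.geometry (Fin 3)) (-t) w j).1)‖ = hsDiameter σ N → w ∈ E) ∧
      ∀ (Φ : HardSphereFlow (Torus.geometry (Fin 3)) (hsDiameter σ N) (N + 1)) (A : V3 × V3 → ℝ≥0∞),
        Measurable A →
        ∫⁻ w, E.indicator (fun w => A ((w i).2, (w j).2)) w
            ∂(localGibbsLaw σ (fun _ => a) (fun _ => u) (fun _ => θ) N Φ) ≤
          ENNReal.ofReal (16 * hsDiameter σ N ^ 2 * h) *
            ∫⁻ p, ENNReal.ofReal ‖p.2 - p.1‖ * A p ∂((gaussMeasure u θ).prod (gaussMeasure u θ)) := by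
  set ε := hsDiameter σ N with hεdef
  -- the event: some lift of the relative position lies in the tube of the relative velocity
  set ψ : (Fin 3 → ℤ) → Config (N + 1) (Fin 3) T3 → V3 × V3 := fun k w =>
    (Torus.reprSym ((w i).1 - (w j).1) + Torus.latticeVec k, (w j).2 - (w i).2) with hψ
  have hψm : ∀ k, Measurable (ψ k) := by
    intro k
    refine Measurable.prodMk ?_ ?_
    · exact (Torus.measurable_reprSym.comp
        ((measurable_pi_apply i).fst.sub (measurable_pi_apply j).fst)).add_const _
    · exact (measurable_pi_apply j).snd.sub (measurable_pi_apply i).snd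
  set E : Set (Config (N + 1) (Fin 3) T3) := ⋃ k, ψ k ⁻¹' {q : V3 × V3 | q.1 ∈ S q.2} with hE
  have hEm : MeasurableSet E := MeasurableSet.iUnion fun k => hSm.preimage (hψm k)
  refine ⟨E, hEm, ?_, ?_⟩
  · intro w hw t ht hc
    obtain ⟨k, hk⟩ := exists_latticeVec_add_mem_of_contact hS hw hij ht hc
    exact mem_iUnion.2 ⟨k, hk⟩
  intro Φ A hA
  -- sections of the tube family are measurable
  have hSu : ∀ v : V3, MeasurableSet (S v) := fun v =>
    hSm.preimage (measurable_id.prodMk measurable_const)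
  -- the position event of a fixed velocity vector
  set T : (Fin (N + 1) → V3) → Set T3 := fun v =>
    {p | ∃ k : Fin 3 → ℤ, Torus.reprSym p + Torus.latticeVec k ∈ S (v j - v i)} with hT
  have hTm : ∀ v, MeasurableSet (T v) := by
    intro v
    have : T v = ⋃ k : Fin 3 → ℤ, (fun p : T3 => Torus.reprSym p + Torus.latticeVec k) ⁻¹'
        S (v j - v i) := by
      ext p; simp only [hT, mem_setOf_eq, mem_iUnion, mem_preimage]
    rw [this]
    exact MeasurableSet.iUnion fun k => (hSu _).preimage (Torus.measurable_reprSym.add_const _)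
  have hTvol : ∀ v, volume (T v) ≤ ENNReal.ofReal (4 * ε ^ 2 * h * ‖v j - v i‖) := fun v =>
    (hlift _ (hSu _)).trans (hSvol _)
  -- the integrand and its measurability
  set F : Config (N + 1) (Fin 3) T3 → ℝ≥0∞ := E.indicator fun w => A ((w i).2, (w j).2) with hF
  have hAm : Measurable fun w : Config (N + 1) (Fin 3) T3 => A ((w i).2, (w j).2) :=
    hA.comp ((measurable_pi_apply i).snd.prodMk (measurable_pi_apply j).snd)
  have hFm : Measurable F := hAm.indicator hEm
  -- disintegrate the rung-0 law
  set Q := posGibbsMeasure (fun _ : T3 => a) ε (N + 1) with hQ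
  set Γ : Measure (Fin (N + 1) → V3) := Measure.pi fun _ => gaussMeasure u θ with hΓ
  have hlaw : localGibbsLaw σ (fun _ => a) (fun _ => u) (fun _ => θ) N Φ = (Q.prod Γ).map zipConfig := by
    rw [localGibbsLaw_eq, localGibbsMeasure_rung0_eq_map σ ha.le hθ u N]
  haveI : IsProbabilityMeasure Q :=
    isProbabilityMeasure_posGibbsMeasure continuous_const (fun _ => ha) hσ2 N
  haveI : IsProbabilityMeasure Γ := by rw [hΓ]; infer_instance
  have hsec : ∀ v : Fin (N + 1) → V3,
      ∫⁻ x, F (zipConfig (x, v)) ∂Q ≤ A (v i, v j) * ENNReal.ofReal (16 * ε ^ 2 * h * ‖v j - v i‖) := by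
    intro v
    have hle : ∀ x, F (zipConfig (x, v)) ≤ {x : Fin (N + 1) → T3 | x i - x j ∈ T v}.indicator
        (fun _ => A (v i, v j)) x := by
      intro x
      by_cases hx : zipConfig (x, v) ∈ E
      · have hx' : x ∈ {x : Fin (N + 1) → T3 | x i - x j ∈ T v} := by
          obtain ⟨k, hk⟩ := mem_iUnion.1 hx
          exact ⟨k, by simpa only [hψ, zipConfig_apply, mem_preimage, mem_setOf_eq] using hk⟩
        rw [hF, indicator_of_mem hx, indicator_of_mem hx']
        simp only [zipConfig_apply, le_refl]
      · rw [hF, indicator_of_notMem hx]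
        exact bot_le
    calc ∫⁻ x, F (zipConfig (x, v)) ∂Q
        ≤ ∫⁻ x, {x : Fin (N + 1) → T3 | x i - x j ∈ T v}.indicator (fun _ => A (v i, v j)) x ∂Q :=
          lintegral_mono hle
      _ ≤ A (v i, v j) * Q {x | x i - x j ∈ T v} := lintegral_indicator_const_le _ _
      _ ≤ A (v i, v j) * (4 * volume (T v)) := by
          have hQ' : Q {x | x i - x j ∈ T v} ≤ 4 * volume (T v) := by
            rw [hQ, posGibbsMeasure_const_eq_one ha]
            exact hpair _ (hTm v)
          gcongr
      _ ≤ A (v i, v j) * (4 * ENNReal.ofReal (4 * ε ^ 2 * h * ‖v j - v i‖)) := by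
          gcongr
          exact hTvol v
      _ = A (v i, v j) * ENNReal.ofReal (16 * ε ^ 2 * h * ‖v j - v i‖) := by
          rw [← ENNReal.ofReal_ofNat 4, ← ENNReal.ofReal_mul (by norm_num)]
          congr 2
          ring
  calc ∫⁻ w, F w ∂(localGibbsLaw σ (fun _ => a) (fun _ => u) (fun _ => θ) N Φ)
      = ∫⁻ pr, F (zipConfig pr) ∂(Q.prod Γ) := by rw [hlaw, lintegral_map hFm measurable_zipConfig]
    _ = ∫⁻ v, ∫⁻ x, F (zipConfig (x, v)) ∂Q ∂Γ :=
        lintegral_prod_symm _ (hFm.comp measurable_zipConfig).aemeasurable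
    _ ≤ ∫⁻ v, A (v i, v j) * ENNReal.ofReal (16 * ε ^ 2 * h * ‖v j - v i‖) ∂Γ := lintegral_mono hsec
    _ = ∫⁻ p, A p * ENNReal.ofReal (16 * ε ^ 2 * h * ‖p.2 - p.1‖)
          ∂((gaussMeasure u θ).prod (gaussMeasure u θ)) := by
        rw [hΓ]
        exact lintegral_pi_pair (gaussMeasure u θ) hij
          (f := fun p : V3 × V3 => A p * ENNReal.ofReal (16 * ε ^ 2 * h * ‖p.2 - p.1‖))
          (hA.mul (by fun_prop))
    _ = ENNReal.ofReal (16 * ε ^ 2 * h) *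
          ∫⁻ p, ENNReal.ofReal ‖p.2 - p.1‖ * A p ∂((gaussMeasure u θ).prod (gaussMeasure u θ)) := by
        rw [← lintegral_const_mul' _ _ ENNReal.ofReal_ne_top]
        refine lintegral_congr fun p => ?_
        rw [ENNReal.ofReal_mul (by positivity)]
        ring

/-! ## The collision-flux upper bound -/

/-- **The collision-flux upper bound (Markov form), rung 0.** For `σ ≤ 1/2`, constant profiles
`a, θ > 0`, `u`, a hard-sphere flow `Φ` of `N + 1` spheres of diameter `ε = hsDiameter σ N` preserving
the homogeneous Gibbs law `G_N` (`hstat`), a canonical pair law at most `4 ×` Haar measure (`hpair`,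
the Ruelle-type bound at small reduced density), swept-tube families of volume `≤ 4 ε² h ‖u‖` for
every window length `h ≥ 0` (`htube`) and the Haar-versus-Lebesgue inequality for minimal-image lifts
(`hlift`): for `τ > 0`, a nonnegative measurable mark `b` of two velocities and `η > 0`, the Gibbs
probability that a GOOD orbit has collision sum
`Σ_{collision times s ∈ [0,τ]} Σ_{ordered contact pairs (i,j)} b(vᵢ(s), vⱼ(s)) ≥ η` is at most
`η⁻¹ · 16 τ (N+1)² ε² · ∫ ‖p.2 − p.1‖ b(p) d(N(u,θ) ⊗ N(u,θ))(p)` (Cercignani–Illner–Pulvirenti 1994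
App. 4.A: the collision flux through the contact cylinders bounds the mean number of collisions).
[folklore] -/
theorem localGibbsLaw_collisionMarkSum_ge_le {σ : ℝ} (hσ2 : σ ≤ 1 / 2) {a θ : ℝ} (ha : 0 < a)
    (hθ : 0 < θ) (u : V3) {N : ℕ} (Φ : HardSphereFlow (Torus.geometry (Fin 3)) (hsDiameter σ N) (N + 1))
    (hstat : ∀ t : ℝ, MeasurePreserving (Φ.flow t) (localGibbsLaw σ (fun _ => a) (fun _ => u) (fun _ => θ) N Φ)
      (localGibbsLaw σ (fun _ => a) (fun _ => u) (fun _ => θ) N Φ))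
    (hpair : ∀ i j : Fin (N + 1), i ≠ j → ∀ T : Set T3, MeasurableSet T →
      posGibbsMeasure (fun _ : T3 => (1 : ℝ)) (hsDiameter σ N) (N + 1) {x | x i - x j ∈ T} ≤ 4 * volume T)
    (htube : ∀ h : ℝ, 0 ≤ h → ∃ S : V3 → Set V3, MeasurableSet {q : V3 × V3 | q.1 ∈ S q.2} ∧
      (∀ u, volume (S u) ≤ ENNReal.ofReal (4 * hsDiameter σ N ^ 2 * h * ‖u‖)) ∧
      ∀ (u r : V3) (s : ℝ), hsDiameter σ N ≤ ‖r‖ → s ∈ Icc 0 h → ‖r + s • u‖ = hsDiameter σ N → r ∈ S u)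
    (hlift : ∀ B : Set V3, MeasurableSet B →
      volume {x : T3 | ∃ k : Fin 3 → ℤ, Torus.reprSym x + Torus.latticeVec k ∈ B} ≤ volume B)
    {τ : ℝ} (hτ : 0 < τ) {b : V3 × V3 → ℝ} (hbm : Measurable b) (hb0 : ∀ p, 0 ≤ b p) {η : ℝ} (hη : 0 < η) :
    localGibbsLaw σ (fun _ => a) (fun _ => u) (fun _ => θ) N Φ
        {z | z ∈ Φ.good ∧ η ≤ ∑ᶠ s ∈ collisionTimes (Torus.geometry (Fin 3)) (hsDiameter σ N)
            (fun t => Φ.flow t z) ∩ Icc 0 τ,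
          ∑ i : Fin (N + 1), ∑ j : Fin (N + 1),
            (if i ≠ j ∧ ‖(Torus.geometry (Fin 3)).sepVec (Φ.flow s z i).1 (Φ.flow s z j).1‖ =
                hsDiameter σ N then b ((Φ.flow s z i).2, (Φ.flow s z j).2) else 0)} ≤
      (ENNReal.ofReal η)⁻¹ * (ENNReal.ofReal (16 * τ * ((N + 1 : ℕ) : ℝ) ^ 2 * hsDiameter σ N ^ 2) *
        ∫⁻ p, ENNReal.ofReal (‖p.2 - p.1‖ * b p) ∂((gaussMeasure u θ).prod (gaussMeasure u θ))) := by
  classical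
  set P := localGibbsLaw σ (fun _ => a) (fun _ => u) (fun _ => θ) N Φ with hPdef
  set A : V3 × V3 → ℝ≥0∞ := fun p => ENNReal.ofReal (b p) with hAdef
  have hAm : Measurable A := hbm.ennreal_ofReal
  set I : ℝ≥0∞ := ∫⁻ p, ENNReal.ofReal ‖p.2 - p.1‖ * A p ∂((gaussMeasure u θ).prod (gaussMeasure u θ))
    with hIdef
  have hI : ∫⁻ p, ENNReal.ofReal (‖p.2 - p.1‖ * b p) ∂((gaussMeasure u θ).prod (gaussMeasure u θ)) = I := by
    refine lintegral_congr fun p => ?_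
    rw [hAdef, ENNReal.ofReal_mul (norm_nonneg _)]
  rw [hI]
  -- the mark: a function of the two (post-collisional) velocities, unchanged along free flight
  set F : Config (N + 1) (Fin 3) T3 → Fin (N + 1) → Fin (N + 1) → ℝ≥0∞ :=
    fun w i j => A ((w i).2, (w j).2) with hFdef
  have hFm : ∀ i j, Measurable fun w => F w i j :=
    fun i j => hAm.comp ((measurable_pi_apply i).snd.prodMk (measurable_pi_apply j).snd)
  have hFfree : ∀ (t : ℝ) (w : Config (N + 1) (Fin 3) T3) (i j : Fin (N + 1)),
      F (freeFlight (Torus.geometry (Fin 3)) (-t) w) i j = F w i j := by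
    intro t w i j
    simp only [hFdef, freeFlight_apply]
  -- the window events, for every mesh `τ / M` and every ordered pair
  have hev : ∀ (M : ℕ) (i j : Fin (N + 1)), ∃ E : Set (Config (N + 1) (Fin 3) T3), MeasurableSet E ∧
      (i ≠ j → ∀ w ∈ hardSphereDomain (Torus.geometry (Fin 3)) (N + 1) (hsDiameter σ N),
        ∀ t ∈ Icc 0 (τ / M),
        ‖(Torus.geometry (Fin 3)).sepVec ((freeFlight (Torus.geometry (Fin 3)) (-t) w i).1)
          ((freeFlight (Torus.geometry (Fin 3)) (-t) w j).1)‖ = hsDiameter σ N → w ∈ E) ∧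
      (i ≠ j → ∫⁻ w, E.indicator (fun w => F w i j) w ∂P ≤
        ENNReal.ofReal (16 * hsDiameter σ N ^ 2 * (τ / M)) * I) := by
    intro M i j
    by_cases hij : i ≠ j
    · have hh : 0 ≤ τ / M := div_nonneg hτ.le (Nat.cast_nonneg M)
      obtain ⟨S, hSm, hSvol, hS⟩ := htube (τ / M) hh
      obtain ⟨E, hEm, hEc, hEb⟩ := exists_windowEvent hσ2 ha hθ u hh hij (hpair i j hij) hSm hSvol hS hlift
      exact ⟨E, hEm, fun _ => hEc, fun _ => hEb Φ A hAm⟩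
    · exact ⟨∅, MeasurableSet.empty, fun h => absurd h hij, fun h => absurd h hij⟩
  choose E hEm hEc hEb using hev
  -- the general window bound
  have hη0 : ENNReal.ofReal η ≠ 0 := (ENNReal.ofReal_pos.2 hη).ne'
  have hgen := measure_collisionSum_ge_le_liminf Φ P hstat hτ F (fun M i j => E M i j) hEm
    (fun M i j hij => hEc M i j hij) (fun _ => F) (fun _ i j => hFm i j)
    (fun M i j _ w _ t _ _ => (hFfree t w i j).le) hη0 ENNReal.ofReal_ne_top
  -- the real collision sum dominates: `ofReal` of the real sum is the `ℝ≥0∞` sum on the good set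
  have hsub : {z | z ∈ Φ.good ∧ η ≤ ∑ᶠ s ∈ collisionTimes (Torus.geometry (Fin 3)) (hsDiameter σ N)
        (fun t => Φ.flow t z) ∩ Icc 0 τ,
      ∑ i : Fin (N + 1), ∑ j : Fin (N + 1),
        (if i ≠ j ∧ ‖(Torus.geometry (Fin 3)).sepVec (Φ.flow s z i).1 (Φ.flow s z j).1‖ = hsDiameter σ N
          then b ((Φ.flow s z i).2, (Φ.flow s z j).2) else 0)} ⊆
      {z | z ∈ Φ.good ∧ ENNReal.ofReal η ≤ ∑ᶠ s ∈ collisionTimes (Torus.geometry (Fin 3))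
          (hsDiameter σ N) (fun t => Φ.flow t z) ∩ Icc 0 τ,
        ∑ i : Fin (N + 1), ∑ j : Fin (N + 1),
          (if i ≠ j ∧ ‖(Torus.geometry (Fin 3)).sepVec (Φ.flow s z i).1 (Φ.flow s z j).1‖ =
              hsDiameter σ N then F (Φ.flow s z) i j else 0)} := by
    rintro z ⟨hz, hle⟩
    refine ⟨hz, ?_⟩
    have hfin := (Φ.isTrajectory z hz).locFinite 0 τ
    rw [finsum_mem_eq_finite_toFinset_sum _ hfin] at hle ⊢
    refine (ENNReal.ofReal_le_ofReal hle).trans (le_of_eq ?_)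
    rw [ENNReal.ofReal_sum_of_nonneg fun s _ => Finset.sum_nonneg fun i _ =>
      Finset.sum_nonneg fun j _ => by split_ifs <;> simp [hb0]]
    refine Finset.sum_congr rfl fun s _ => ?_
    rw [ENNReal.ofReal_sum_of_nonneg fun i _ => Finset.sum_nonneg fun j _ => by split_ifs <;> simp [hb0]]
    refine Finset.sum_congr rfl fun i _ => ?_
    rw [ENNReal.ofReal_sum_of_nonneg fun j _ => by split_ifs <;> simp [hb0]]
    refine Finset.sum_congr rfl fun j _ => ?_
    rw [apply_ite ENNReal.ofReal, ENNReal.ofReal_zero]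
  -- the mean of one window: the static bound, `(N+1)²` ordered pairs, and `M · (τ/M) = τ`
  have hB : ∀ M : ℕ, (M : ℝ≥0∞) * ∫⁻ w, ∑ i, ∑ j,
      (if i ≠ j then (E M i j).indicator (fun w => F w i j) w else 0) ∂P ≤
        ENNReal.ofReal (16 * τ * ((N + 1 : ℕ) : ℝ) ^ 2 * hsDiameter σ N ^ 2) * I := by
    intro M
    rcases Nat.eq_zero_or_pos M with hM0 | hM0
    · subst hM0
      simp only [Nat.cast_zero, zero_mul, zero_le]
    have hM' : (0 : ℝ) < M := by exact_mod_cast hM0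
    have hterm : ∀ i j : Fin (N + 1), ∫⁻ w, (if i ≠ j then (E M i j).indicator
        (fun w => F w i j) w else 0) ∂P ≤ ENNReal.ofReal (16 * hsDiameter σ N ^ 2 * (τ / M)) * I := by
      intro i j
      by_cases hij : i ≠ j
      · simp only [if_pos hij]; exact hEb M i j hij
      · simp only [if_neg hij, lintegral_zero, zero_le]
    have hmeas : ∀ i j : Fin (N + 1), Measurable fun w : Config (N + 1) (Fin 3) T3 =>
        (if i ≠ j then (E M i j).indicator (fun w => F w i j) w else 0) := by
      intro i j
      by_cases hij : i ≠ j
      · simp only [if_pos hij]; exact (hFm i j).indicator (hEm M i j)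
      · simp only [if_neg hij]; exact measurable_const
    calc (M : ℝ≥0∞) * ∫⁻ w, ∑ i, ∑ j, (if i ≠ j then (E M i j).indicator (fun w => F w i j) w else 0) ∂P
        = (M : ℝ≥0∞) * ∑ i, ∑ j, ∫⁻ w, (if i ≠ j then (E M i j).indicator (fun w => F w i j) w else 0) ∂P := by
          congr 1
          rw [lintegral_finsetSum _ fun i _ => Finset.measurable_sum _ fun j _ => hmeas i j]
          exact Finset.sum_congr rfl fun i _ => lintegral_finsetSum _ fun j _ => hmeas i j
      _ ≤ (M : ℝ≥0∞) * ∑ _i : Fin (N + 1), ∑ _j : Fin (N + 1), ENNReal.ofReal (16 * hsDiameter σ N ^ 2 * (τ / M)) * I := by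
          gcongr with i _ j _
          exact hterm i j
      _ = ENNReal.ofReal (16 * τ * ((N + 1 : ℕ) : ℝ) ^ 2 * hsDiameter σ N ^ 2) * I := by
          simp only [Finset.sum_const, Finset.card_univ, Fintype.card_fin, nsmul_eq_mul]
          have h1 : (M : ℝ≥0∞) = ENNReal.ofReal (M : ℝ) := (ENNReal.ofReal_natCast M).symm
          have h2 : ((N + 1 : ℕ) : ℝ≥0∞) = ENNReal.ofReal ((N + 1 : ℕ) : ℝ) := (ENNReal.ofReal_natCast _).symm
          rw [h1, h2, ← mul_assoc, ← mul_assoc, ← mul_assoc, ← ENNReal.ofReal_mul (Nat.cast_nonneg _),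
            ← ENNReal.ofReal_mul (by positivity), ← ENNReal.ofReal_mul (by positivity)]
          congr 1
          congr 1
          field_simp
  calc P _ ≤ P _ := measure_mono hsub
    _ ≤ _ := hgen
    _ ≤ (ENNReal.ofReal η)⁻¹ * (ENNReal.ofReal (16 * τ * ((N + 1 : ℕ) : ℝ) ^ 2 * hsDiameter σ N ^ 2) * I) := by
        gcongr
        exact liminf_le_of_frequently_le' (Frequently.of_forall hB)

end Literature.MathematicalPhysics.KineticTheory

end
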